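import Literature.AlgebraicGeometry.Motives.CurveLinearSystemMorphism
import Literature.AlgebraicGeometry.Motives.CurveSignedFamilies
import Literature.AlgebraicGeometry.Motives.CurveSymmetricChart
import HarnessLib

/-!
# Opens of `C⁽ᵍ⁾`, `C⁽ᵍ⁾ × C⁽ᵍ⁾` and `Cᵍ` cut out by linear-system conditions

For Weil's construction of the Jacobian of a smooth projective curve `C` over an algebraically
closed field `K` (Milne, *Jacobian Varieties*, §7) one needs, as OPEN subschemes, the loci of
points `y` of the symmetric power `C⁽ᵍ⁾` (resp. pairs `(y₁, y₂)`, resp. tuples `τ ∈ Cᵍ`) where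
`ℓ(Ê(y) + c) ≤ 1` for a fixed divisor `c = Σ[Aᵢ] − Σ[Bⱼ]` (`Ê(y)` the effective divisor of degree
`g` that `y` "is"). This file provides them, characterised by their `K`-points:

* `exists_opens_pt_mem_iff_ell_le` — the engine: for a family of divisors `D` on `C × B` over an
  integral `B` mapping onto `T` by a universally closed surjection `p` with `h⁰(D_b) = ℓ(d(p b))`,
  the `K`-points `t` with `ℓ(d t) ≤ n` are the `K`-points of an open of `T` (complement of the image
  of the closed set `{h⁰ ≥ n + 1}` of semicontinuity, `CechPseudoCoherentAt.isClosed_setOf_le_h0`,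
  Görtz–Wedhorn II 23.139);
* `exists_opens_powC_pt_mem_iff`, `exists_opens_symPowProj_pt_mem_iff`(`_neg`),
  `exists_opens_tensor_symPowProj_pt_mem_iff` — the instances on `Cᴺ`, `C⁽ᵍ⁾` (both signs of
  `Ê`) and `C⁽ᵍ⁾ × C⁽ᵍ⁾`, via the signed families of `Motives/CurveSignedFamilies` twisted by
  constant maps (`CurvePlaces.const`, `h0_signedFamily_append_const`);
* tools on `K`-points of schemes locally of finite type over `K = K̄` (Nullstellensatz /
  Jacobson): `eq_univ_of_isOpen_of_forall_pt_mem`, `Opens.le_of_forall_pt_mem`,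
  `Opens.ext_of_forall_pt_mem_iff` (opens are determined by their `K`-points),
  `forall_mem_of_forall_pt_mem`, `opensOfAlgPoints` (the largest open whose `K`-points satisfy a
  predicate, `pt_mem_opensOfAlgPoints_iff`), `AlgPoints.specOver_eq_id`, `unitToSpecOver`;
* notation-level definitions `CurvePlaces.ptDiv` (`[Q]`), `tupleDiv` (`Σⱼ[Rⱼ]`), `liftDiv` (`Ê(y)`,
  `liftDiv_comp_mk`, `pt_mem_chartW_iff : y ∈ W ↔ ℓ(Ê(y)) = 1`), `const`/`comp_const`.

Everything is proved; the `def`s are constructions with bodies (D-0026), no named facts.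

## References

* J. S. Milne, *Jacobian Varieties*, in Cornell–Silverman (eds.), *Arithmetic Geometry* (1986),
  §4 Prop. 4.2 (a), §5 Thm. 5.1, §7. [Milne1986JacobianVarieties]
* U. Görtz, T. Wedhorn, *Algebraic Geometry II* (2023), Thm. 23.139. [GortzWedhorn2023]
-/

noncomputable section

universe u

open CategoryTheory CategoryTheory.Limits AlgebraicGeometry MonoidalCategory CartesianMonoidalCategory
  TopologicalSpace
open Literature.NumberTheory.DiophantineGeometry
open Literature.NumberTheory.DiophantineGeometry.AlgFunctionField
open Literature.AlgebraicGeometry.RelativeSpec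

namespace Literature.AlgebraicGeometry.Motives

/-! ### `K`-points and opens of schemes locally of finite type over `K = K̄` -/

section KPointsOpens

variable {K : Type u} [Field K] [IsAlgClosed K] {X Y : SchemeOver K} [LocallyOfFiniteType X.hom]

/-- **An open subset containing every `K`-point is everything** (its closed complement would
contain a closed point, i.e. a `K`-point, by the Nullstellensatz). [folklore] -/
theorem eq_univ_of_isOpen_of_forall_pt_mem {U : Set X.left} (hU : IsOpen U)
    (h : ∀ z : AlgPoints X K, z.pt ∈ U) : U = Set.univ := by
  by_contra hne
  obtain ⟨z, hz⟩ := AlgPoints.exists_pt_mem_of_isClosed (X := X) hU.isClosed_compl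
    (Set.nonempty_compl.mpr hne)
  exact hz (h z)

/-- **Opens are compared on `K`-points**: `U ⊆ V` as soon as every `K`-point of `U` lies in `V`
(the locally closed `U \\ V` would otherwise contain a closed point). [folklore] -/
theorem Opens.le_of_forall_pt_mem {U V : X.left.Opens}
    (h : ∀ z : AlgPoints X K, z.pt ∈ U → z.pt ∈ V) : U ≤ V := by
  intro x hx
  by_contra hxV
  haveI : JacobsonSpace X.left := LocallyOfFiniteType.jacobsonSpace X.hom
  have hlc : IsLocallyClosed ((U : Set X.left) ∩ (V : Set X.left)ᶜ) :=
    U.2.isLocallyClosed.inter V.2.isClosed_compl.isLocallyClosed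
  obtain ⟨y, ⟨hyU, hyV⟩, hycl⟩ :=
    nonempty_inter_closedPoints (Z := (U : Set X.left) ∩ (V : Set X.left)ᶜ) ⟨x, hx, hxV⟩ hlc
  obtain ⟨z, rfl⟩ := AlgPoints.exists_pt_eq_of_isClosed_singleton (X := X) (mem_closedPoints_iff.mp hycl)
  exact hyV (h z hyU)

/-- Opens with the same `K`-points are equal. [folklore] -/
theorem Opens.ext_of_forall_pt_mem_iff {U V : X.left.Opens}
    (h : ∀ z : AlgPoints X K, z.pt ∈ U ↔ z.pt ∈ V) : U = V :=
  le_antisymm (Opens.le_of_forall_pt_mem fun z ↦ (h z).1) (Opens.le_of_forall_pt_mem fun z ↦ (h z).2)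

/-- **A morphism maps into an open as soon as it does so on `K`-points.** [folklore] -/
theorem forall_mem_of_forall_pt_mem (f : X ⟶ Y) {U : Set Y.left} (hU : IsOpen U)
    (h : ∀ z : AlgPoints X K, AlgPoints.pt (z ≫ f) ∈ U) (x : X.left) : f.left x ∈ U := by
  have e := eq_univ_of_isOpen_of_forall_pt_mem (X := X) (hU.preimage f.left.continuous)
    fun z ↦ by rw [Set.mem_preimage, ← AlgPoints.pt_comp]; exact h z
  have : x ∈ f.left ⁻¹' U := by rw [e]; trivial
  exact this

variable (X) in
/-- **The largest open whose `K`-points satisfy `P`.** When SOME open has exactly the `K`-points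
satisfying `P` (e.g. by semicontinuity), this is that open (`pt_mem_opensOfAlgPoints_iff`), now
given canonically. [folklore] -/
def opensOfAlgPoints (P : AlgPoints X K → Prop) : X.left.Opens :=
  sSup {U | ∀ z : AlgPoints X K, z.pt ∈ U → P z}

omit [IsAlgClosed K] [LocallyOfFiniteType X.hom] in
/-- `K`-points of `opensOfAlgPoints P` satisfy `P`. [folklore] -/
theorem of_pt_mem_opensOfAlgPoints {P : AlgPoints X K → Prop} {z : AlgPoints X K}
    (hz : z.pt ∈ opensOfAlgPoints X P) : P z := by
  simp only [opensOfAlgPoints] at hz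
  obtain ⟨U, hU, hzU⟩ := Opens.mem_sSup.mp hz
  exact hU z hzU

omit [IsAlgClosed K] [LocallyOfFiniteType X.hom] in
/-- An open whose `K`-points satisfy `P` is contained in `opensOfAlgPoints P`. [folklore] -/
theorem le_opensOfAlgPoints {P : AlgPoints X K → Prop} {U : X.left.Opens}
    (hU : ∀ z : AlgPoints X K, z.pt ∈ U → P z) : U ≤ opensOfAlgPoints X P :=
  le_sSup hU

omit [IsAlgClosed K] [LocallyOfFiniteType X.hom] in
/-- **If some open has exactly the `K`-points satisfying `P`, so does `opensOfAlgPoints P`.** [folklore] -/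
theorem pt_mem_opensOfAlgPoints_iff {P : AlgPoints X K → Prop}
    (h : ∃ U : X.left.Opens, ∀ z : AlgPoints X K, z.pt ∈ U ↔ P z) (z : AlgPoints X K) :
    z.pt ∈ opensOfAlgPoints X P ↔ P z := by
  obtain ⟨U, hU⟩ := h
  exact ⟨of_pt_mem_opensOfAlgPoints, fun hz ↦ le_opensOfAlgPoints (fun z ↦ (hU z).1) ((hU z).2 hz)⟩

/-- **The only `K`-endomorphism of `Spec K` over `K` is the identity.** [folklore] -/
theorem AlgPoints.specOver_eq_id (s : AlgPoints (specOver K K) K) : s = 𝟙 _ := by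
  haveI : Subsingleton ↥(specOver K K).left := inferInstanceAs (Subsingleton (PrimeSpectrum K))
  exact AlgPoints.eq_of_pt_eq (Subsingleton.elim _ _)

variable (K) in
/-- The `K`-morphism `𝟙_ = (Spec K, 𝟙) → (Spec K, Spec (algebraMap K K)) = specOver K K`. [folklore] -/
def unitToSpecOver : 𝟙_ (SchemeOver K) ⟶ specOver K K :=
  Over.homMk (𝟙 _) (by
    change 𝟙 _ ≫ CurvePlaces.strPt (K := K) K = 𝟙 _
    rw [CurvePlaces.strPt_self, Category.comp_id])

omit [IsAlgClosed K] [LocallyOfFiniteType X.hom] in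
/-- `toUnit (Spec K) ≫ unitToSpecOver = 𝟙`. [folklore] -/
theorem toUnit_unitToSpecOver : toUnit (specOver K K) ≫ unitToSpecOver K = 𝟙 _ := by
  ext : 1
  change (toUnit (specOver K K)).left ≫ 𝟙 _ = 𝟙 (Spec (.of K))
  rw [Category.comp_id]
  have h := Over.w (toUnit (specOver K K))
  have h' : (toUnit (specOver K K)).left = (specOver K K).hom := by
    rw [← h]; exact (Category.comp_id _).symm
  rw [h']
  exact CurvePlaces.strPt_self

end KPointsOpens

/-! ### Divisors of `K`-points, constant maps -/

namespace CurvePlaces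

open RatFn FieldPoint CartierDivisor

section PtDiv

variable {K : Type u} [Field K] (C : SchemeOver K)
  [SmoothOfRelativeDimension 1 C.hom] [IsProper C.hom] [GeometricallyIntegral C.hom]

/-- **The divisor `[Q]` of a `K`-point `Q` of `C`** (the place of `K(C_K)/K` centred at `Q`, with
multiplicity one). [folklore] -/
abbrev ptDiv (Q : AlgPoints C K) : Divisor K (curveBC C (strPt (K := K) K)).left.functionField :=
  Finsupp.single (place (curveBC C (strPt (K := K) K)) (ratPtPoint C _ Q)
    (ratPtPoint_ne_genericPoint C _ Q)) 1

/-- **The divisor `Σⱼ [Rⱼ]` of a tuple of `K`-points.** [folklore] -/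
abbrev tupleDiv {n : ℕ} (R : Fin n → AlgPoints C K) :
    Divisor K (curveBC C (strPt (K := K) K)).left.functionField :=
  ∑ j, ptDiv C (R j)

/-- `Σⱼ [Rⱼ]` is the coordinate divisor of the `K`-point `(R₁, …, R_n)` of `Cⁿ`. [folklore] -/
theorem coordDivisorAt_tuplePt_eq_tupleDiv {n : ℕ} (R : Fin n → AlgPoints C K) :
    coordDivisorAt C n (strPt (K := K) K) (tuplePt C _ R) = tupleDiv C R := by
  rw [coordDivisorAt_tuplePt]

/-- `deg [Q] = 1` over `K = K̄`. [folklore] -/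
theorem degree_ptDiv [IsAlgClosed K] (Q : AlgPoints C K) : (ptDiv C Q).degree = 1 := by
  rw [Divisor.degree_single, PlaceOver.degree_eq_one_of_isAlgClosed']
  simp

/-- `deg Σⱼ [Rⱼ] = n`. [folklore] -/
theorem degree_tupleDiv [IsAlgClosed K] {n : ℕ} (R : Fin n → AlgPoints C K) :
    (tupleDiv C R).degree = n :=
  Divisor.degree_sum_single_eq _

/-- `0 ≤ [Q]`. [folklore] -/
theorem ptDiv_nonneg (Q : AlgPoints C K) : 0 ≤ ptDiv C Q :=
  Finsupp.single_nonneg.mpr zero_le_one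

/-- `0 ≤ Σⱼ [Rⱼ]`. [folklore] -/
theorem tupleDiv_nonneg {n : ℕ} (R : Fin n → AlgPoints C K) : 0 ≤ tupleDiv C R :=
  Finset.sum_nonneg fun j _ ↦ ptDiv_nonneg C (R j)

/-- `Σ (append R R') = Σ R + Σ R'`. [folklore] -/
theorem tupleDiv_append {n n' : ℕ} (R : Fin n → AlgPoints C K) (R' : Fin n' → AlgPoints C K) :
    tupleDiv C (Fin.append R R') = tupleDiv C R + tupleDiv C R' := by
  simp only [tupleDiv, Fin.sum_univ_add, Fin.append_left, Fin.append_right]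

variable (g : ℕ) (hC : IsProjectiveOver C)

/-- **The divisor `Ê(y)` of a `K`-point `y` of `C⁽ᵍ⁾`**: the coordinate divisor `Σⱼ [τⱼ]` of a
lift `τ ∈ Cᵍ(K)` of `y` (independent of the lift, `coordDivisorAt_eq_of_mk_eq`). [cite: Milne1986JacobianVarieties, §3 Prop. 3.1] -/
def liftDiv [IsAlgClosed K] (y : AlgPoints (symPowProj C hC g) K) :
    Divisor K (curveBC C (strPt (K := K) K)).left.functionField :=
  tupleDiv C (Classical.choose (exists_tuplePt_mk_eq C g hC y))

/-- `Ê(τ ≫ (Cᵍ → C⁽ᵍ⁾)) = Σⱼ [τⱼ]`. [folklore] -/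
theorem liftDiv_comp_mk [IsAlgClosed K] (τ : AlgPoints (powC C g) K) :
    liftDiv C g hC (τ ≫ symPowProj.mk C hC g) = coordDivisorAt C g (strPt (K := K) K) τ := by
  unfold liftDiv
  rw [← coordDivisorAt_tuplePt_eq_tupleDiv]
  exact coordDivisorAt_eq_of_mk_eq C g hC
    (Classical.choose_spec (exists_tuplePt_mk_eq C g hC (τ ≫ symPowProj.mk C hC g)))

/-- `Ê((R₁, …, R_g) ≫ (Cᵍ → C⁽ᵍ⁾)) = Σⱼ [Rⱼ]`. [folklore] -/
theorem liftDiv_tuplePt_mk [IsAlgClosed K] (R : Fin g → AlgPoints C K) :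
    liftDiv C g hC (tuplePt C (strPt (K := K) K) R ≫ symPowProj.mk C hC g) = tupleDiv C R := by
  rw [liftDiv_comp_mk, coordDivisorAt_tuplePt_eq_tupleDiv]

/-- `deg Ê(y) = g`. [folklore] -/
theorem degree_liftDiv [IsAlgClosed K] (y : AlgPoints (symPowProj C hC g) K) :
    (liftDiv C g hC y).degree = g :=
  degree_tupleDiv C _

/-- `0 ≤ Ê(y)`. [folklore] -/
theorem liftDiv_nonneg [IsAlgClosed K] (y : AlgPoints (symPowProj C hC g) K) : 0 ≤ liftDiv C g hC y :=
  tupleDiv_nonneg C _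

/-- **`K`-points of the chart `W`**: `y ∈ W` iff `ℓ(Ê(y)) = 1`. [cite: Milne1986JacobianVarieties, §5 Thm. 5.1 (a)] -/
theorem pt_mem_chartW_iff [IsAlgClosed K] [IsIntegral C.left] (y : AlgPoints (symPowProj C hC g) K) :
    y.pt ∈ chartW C g hC ↔ ell (liftDiv C g hC y) = 1 := by
  obtain ⟨R, rfl⟩ := exists_tuplePt_mk_eq C g hC y
  rw [liftDiv_tuplePt_mk, pt_comp_mk, ← Set.mem_preimage, preimage_chartW,
    imagePtPow_mem_generalLocus_iff, coordDivisorAt_tuplePt_eq_tupleDiv]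

/-- **The constant map `B → C` at a `K`-point `Q`.** [folklore] -/
def const (B : SchemeOver K) (Q : AlgPoints C K) : B ⟶ C :=
  toUnit B ≫ unitToSpecOver K ≫ Q

omit [SmoothOfRelativeDimension 1 C.hom] [IsProper C.hom] [GeometricallyIntegral C.hom] in
/-- A `K`-point followed by the constant map at `Q` is `Q`. [folklore] -/
@[simp]
theorem comp_const {B : SchemeOver K} (b : AlgPoints B K) (Q : AlgPoints C K) :
    b ≫ const C B Q = Q := by
  rw [const, ← Category.assoc, comp_toUnit, ← Category.assoc, toUnit_unitToSpecOver, Category.id_comp]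

omit [SmoothOfRelativeDimension 1 C.hom] [IsProper C.hom] [GeometricallyIntegral C.hom] in
/-- Constant maps are stable under precomposition. [folklore] -/
@[simp]
theorem comp_const' {B B' : SchemeOver K} (f : B' ⟶ B) (Q : AlgPoints C K) :
    f ≫ const C B Q = const C B' Q := by
  rw [const, const, ← Category.assoc, comp_toUnit]

end PtDiv

end CurvePlaces

/-! ### Opens cut out by `ℓ ≤ n` (semicontinuity) -/

section Engine

open RatFn FieldPoint CartierDivisor CurvePlaces

variable {K : Type u} [Field K] [IsAlgClosed K]
  (C : SchemeOver K) [SmoothOfRelativeDimension 1 C.hom] [IsProper C.hom] [GeometricallyIntegral C.hom]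
  (hX : CechPseudoCoherentAt C)

omit [SmoothOfRelativeDimension 1 C.hom] in
include hX in
/-- **The engine: `{t : ℓ(d t) ≤ n}` is open.** Given a family of divisors `D` on `C × B` over an
integral parameter scheme `B` mapping onto `T` by a universally closed `p`, with
`h⁰(D_b) = ℓ(d(p b))` on `K`-points, the `K`-points `t` of `T` with `ℓ(d t) ≤ n` are exactly the
`K`-points of an open of `T`: the complement of the (closed) image of the closed set
`{h⁰ ≥ n + 1}` of semicontinuity (`CechPseudoCoherentAt.isClosed_setOf_le_h0`). [cite: Milne1986JacobianVarieties, §4 Prop. 4.2 (a) and §5 (proof of Thm. 5.1)] -/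
theorem exists_opens_pt_mem_iff_ell_le (T : SchemeOver K) [LocallyOfFiniteType T.hom]
    (B : SchemeOver K) [LocallyOfFiniteType B.hom] [IsIntegral B.left] [IsIntegral (C ⊗ B).left]
    (p : B ⟶ T) [Surjective p.left] [UniversallyClosed p.left]
    (D : CartierDivisor (C ⊗ B).left)
    (d : AlgPoints T K → Divisor K (curveBC C (strPt (K := K) K)).left.functionField)
    (hD : ∀ β : AlgPoints B K, letI := fibreOverField C (strPt (K := K) K)
      (D.classPullback (C ◁ β).left).h0 K = ell (d (β ≫ p))) (n : ℕ) :
    ∃ U : T.left.Opens, ∀ t : AlgPoints T K, t.pt ∈ U ↔ ell (d t) ≤ n := by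
  obtain ⟨S, hSdef⟩ : ∃ S : Set B.left, S = {b | letI := fibreOverResidueField C B b;
      n + 1 ≤ (D.classPullback (C ◁ residuePtι B b).left).h0 (B.left.residueField b)} := ⟨_, rfl⟩
  have hS : IsClosed S := by rw [hSdef]; exact CechPseudoCoherentAt.isClosed_setOf_le_h0 hX B D (n + 1)
  have hmemS : ∀ β : AlgPoints B K, β.pt ∈ S ↔ n + 1 ≤ ell (d (β ≫ p)) := fun β ↦ by
    rw [hSdef, ← hD]
    exact (le_h0_classPullback_algPoint_iff C B D (n + 1) β).symm
  have hS' : IsClosed (p.left '' S) := p.left.isClosedMap _ hS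
  refine ⟨⟨(p.left '' S)ᶜ, hS'.isOpen_compl⟩, fun t ↦ ?_⟩
  change t.pt ∈ (p.left '' S)ᶜ ↔ _
  rw [Set.mem_compl_iff]
  constructor
  · intro ht
    by_contra hlt
    obtain ⟨β, hβ⟩ := AlgPoints.exists_comp_eq_of_surjective p t
    refine ht ⟨β.pt, (hmemS β).mpr ?_, by rw [← AlgPoints.pt_comp, hβ]⟩
    rw [hβ]; omega
  · rintro ht ⟨b₀, hb₀S, hb₀⟩
    obtain ⟨β, hβS, hβ⟩ : ∃ β : AlgPoints B K, β.pt ∈ S ∧ β ≫ p = t := by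
      obtain ⟨β, hβ⟩ := AlgPoints.exists_pt_mem_of_isClosed (X := B)
        (hS.inter (IsClosed.preimage p.left.continuous t.isClosed_singleton_pt)) ⟨b₀, hb₀S, hb₀⟩
      refine ⟨β, hβ.1, AlgPoints.eq_of_pt_eq ?_⟩
      rw [AlgPoints.pt_comp]
      exact hβ.2
    have h1 := (hmemS β).mp hβS
    rw [hβ] at h1
    omega

omit [IsAlgClosed K] in
/-- `(f ⊗ g).left` is surjective if `f.left` and `g.left` are. [folklore] -/
theorem surjective_tensorHom_left {X X' Y Y' : SchemeOver K} (f : X ⟶ X') (g : Y ⟶ Y')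
    [Surjective f.left] [Surjective g.left] : Surjective (f ⊗ₘ g).left := by
  rw [tensorHom_def, Over.comp_left]
  haveI : Surjective (f ▷ Y).left :=
    MorphismProperty.of_isPullback (P := @Surjective) (isPullback_whiskerRight_left' f Y).flip inferInstance
  haveI : Surjective (X' ◁ g).left :=
    MorphismProperty.of_isPullback (P := @Surjective)
      (Limits.SubalgApprox.isPullback_whiskerLeft_left X' g).flip inferInstance
  infer_instance

variable [IsIntegral C.left] (g : ℕ) (hC : IsProjectiveOver C)

omit [IsAlgClosed K] in
/-- `h⁰` of the signed family with positive maps `append u (const A)` and negative maps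
`append u' (const B)` over a `K`-point `β`: `ℓ(Σ[β ≫ u] + Σ[A] − Σ[β ≫ u'] − Σ[B])`. [folklore] -/
theorem h0_signedFamily_append_const (B₀ : SchemeOver K) [IsIntegral (C ⊗ B₀).left]
    {M M' a b : ℕ} (u : Fin M → (B₀ ⟶ C)) (u' : Fin M' → (B₀ ⟶ C))
    (A : Fin a → AlgPoints C K) (Bn : Fin b → AlgPoints C K) (β : AlgPoints B₀ K) :
    letI := fibreOverField C (strPt (K := K) K)
    (((sumDivisor fun m ↦ (diagonalDivisor C).classPullback
        (C ◁ Fin.append u (fun i ↦ const C B₀ (A i)) m).left) +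
      -(sumDivisor fun m ↦ (diagonalDivisor C).classPullback
        (C ◁ Fin.append u' (fun i ↦ const C B₀ (Bn i)) m).left)).classPullback (C ◁ β).left).h0 K =
      ell ((∑ m, ptDiv C (β ≫ u m)) + tupleDiv C A - ((∑ m, ptDiv C (β ≫ u' m)) + tupleDiv C Bn)) := by
  rw [h0_signedFamily_fieldPoint]
  congr 1
  simp only [Fin.sum_univ_add, Fin.append_left, Fin.append_right, comp_const, tupleDiv, ptDiv]

include hX in
/-- **The open `{τ ∈ Cᴺ : ℓ(Σⱼ[τⱼ] + Σ[A] − Σ[B]) ≤ n}` of `Cᴺ`** (on `K`-points). [cite: Milne1986JacobianVarieties, §4 Prop. 4.2 (a)] -/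
theorem exists_opens_powC_pt_mem_iff (N n : ℕ) {a b : ℕ} (A : Fin a → AlgPoints C K)
    (Bn : Fin b → AlgPoints C K) :
    ∃ U : (powC C N).left.Opens, ∀ R : Fin N → AlgPoints C K,
      AlgPoints.pt (tuplePt C (strPt (K := K) K) R) ∈ U ↔
        ell (tupleDiv C R + tupleDiv C A - tupleDiv C Bn) ≤ n := by
  let D : CartierDivisor (C ⊗ powC C N).left :=
    (sumDivisor fun m ↦ (diagonalDivisor C).classPullback
        (C ◁ Fin.append (fun j ↦ coord C N j) (fun i ↦ const C (powC C N) (A i)) m).left) +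
      -(sumDivisor fun m ↦ (diagonalDivisor C).classPullback
        (C ◁ Fin.append (Fin.elim0 : Fin 0 → (powC C N ⟶ C)) (fun i ↦ const C (powC C N) (Bn i)) m).left)
  obtain ⟨U, hU⟩ := exists_opens_pt_mem_iff_ell_le C hX (powC C N) (powC C N) (𝟙 _) D
    (fun τ ↦ coordDivisorAt C N (strPt (K := K) K) τ + tupleDiv C A - tupleDiv C Bn) (fun β ↦ by
      rw [h0_signedFamily_append_const, Category.comp_id]
      simp only [Finset.univ_eq_empty, Finset.sum_empty, zero_add, coordDivisorAt, ptDiv]) n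
  refine ⟨U, fun R ↦ ?_⟩
  rw [hU, coordDivisorAt_tuplePt_eq_tupleDiv]

include hX in
/-- **The open `{y ∈ C⁽ᵍ⁾ : ℓ(Ê(y) + Σ[A] − Σ[B]) ≤ n}` of `C⁽ᵍ⁾`** (on `K`-points; the image under
the finite `Cᵍ → C⁽ᵍ⁾` of the complement of a saturated closed set). [cite: Milne1986JacobianVarieties, §4 Prop. 4.2 (a) and §5 (proof of Thm. 5.1)] -/
theorem exists_opens_symPowProj_pt_mem_iff (n : ℕ) {a b : ℕ} (A : Fin a → AlgPoints C K)
    (Bn : Fin b → AlgPoints C K) :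
    ∃ U : (symPowProj C hC g).left.Opens, ∀ R : Fin g → AlgPoints C K,
      AlgPoints.pt (tuplePt C (strPt (K := K) K) R ≫ symPowProj.mk C hC g) ∈ U ↔
        ell (tupleDiv C R + tupleDiv C A - tupleDiv C Bn) ≤ n := by
  haveI := symPowProj.isProper_hom C hC g
  haveI := symPowProj.surjective_mk_left C hC g
  haveI := symPowProj.isFinite_mk_left C hC g
  let D : CartierDivisor (C ⊗ powC C g).left :=
    (sumDivisor fun m ↦ (diagonalDivisor C).classPullback
        (C ◁ Fin.append (fun j ↦ coord C g j) (fun i ↦ const C (powC C g) (A i)) m).left) +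
      -(sumDivisor fun m ↦ (diagonalDivisor C).classPullback
        (C ◁ Fin.append (Fin.elim0 : Fin 0 → (powC C g ⟶ C)) (fun i ↦ const C (powC C g) (Bn i)) m).left)
  obtain ⟨U, hU⟩ := exists_opens_pt_mem_iff_ell_le C hX (symPowProj C hC g) (powC C g)
    (symPowProj.mk C hC g) D (fun y ↦ liftDiv C g hC y + tupleDiv C A - tupleDiv C Bn) (fun β ↦ by
      rw [h0_signedFamily_append_const, liftDiv_comp_mk]
      simp only [Finset.univ_eq_empty, Finset.sum_empty, zero_add, coordDivisorAt, ptDiv]) n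
  refine ⟨U, fun R ↦ ?_⟩
  rw [hU, liftDiv_tuplePt_mk]

include hX in
/-- **The open `{y ∈ C⁽ᵍ⁾ : ℓ(−Ê(y) + Σ[A] − Σ[B]) ≤ n}` of `C⁽ᵍ⁾`** (on `K`-points). [cite: Milne1986JacobianVarieties, §4 Prop. 4.2 (a) and §7 (Weil's construction)] -/
theorem exists_opens_symPowProj_pt_mem_iff_neg (n : ℕ) {a b : ℕ} (A : Fin a → AlgPoints C K)
    (Bn : Fin b → AlgPoints C K) :
    ∃ U : (symPowProj C hC g).left.Opens, ∀ R : Fin g → AlgPoints C K,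
      AlgPoints.pt (tuplePt C (strPt (K := K) K) R ≫ symPowProj.mk C hC g) ∈ U ↔
        ell (-tupleDiv C R + tupleDiv C A - tupleDiv C Bn) ≤ n := by
  haveI := symPowProj.isProper_hom C hC g
  haveI := symPowProj.surjective_mk_left C hC g
  haveI := symPowProj.isFinite_mk_left C hC g
  let D : CartierDivisor (C ⊗ powC C g).left :=
    (sumDivisor fun m ↦ (diagonalDivisor C).classPullback
        (C ◁ Fin.append (Fin.elim0 : Fin 0 → (powC C g ⟶ C)) (fun i ↦ const C (powC C g) (A i)) m).left) +
      -(sumDivisor fun m ↦ (diagonalDivisor C).classPullback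
        (C ◁ Fin.append (fun j ↦ coord C g j) (fun i ↦ const C (powC C g) (Bn i)) m).left)
  obtain ⟨U, hU⟩ := exists_opens_pt_mem_iff_ell_le C hX (symPowProj C hC g) (powC C g)
    (symPowProj.mk C hC g) D (fun y ↦ -liftDiv C g hC y + tupleDiv C A - tupleDiv C Bn) (fun β ↦ by
      rw [h0_signedFamily_append_const, liftDiv_comp_mk]
      simp only [Finset.univ_eq_empty, Finset.sum_empty, zero_add, coordDivisorAt, ptDiv]
      congr 1
      abel) n
  refine ⟨U, fun R ↦ ?_⟩
  rw [hU, liftDiv_tuplePt_mk]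

include hX in
/-- **The open `{(y₁, y₂) ∈ C⁽ᵍ⁾ × C⁽ᵍ⁾ : ℓ(Ê(y₁) + Ê(y₂) + Σ[A] − Σ[B]) ≤ n}`** (on `K`-points). [cite: Milne1986JacobianVarieties, §7 (Weil's construction: the group law on an open of `C⁽ᵍ⁾ × C⁽ᵍ⁾`)] -/
theorem exists_opens_tensor_symPowProj_pt_mem_iff (n : ℕ) {a b : ℕ} (A : Fin a → AlgPoints C K)
    (Bn : Fin b → AlgPoints C K) :
    ∃ U : (symPowProj C hC g ⊗ symPowProj C hC g).left.Opens, ∀ R₁ R₂ : Fin g → AlgPoints C K,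
      AlgPoints.pt (lift (tuplePt C (strPt (K := K) K) R₁ ≫ symPowProj.mk C hC g)
        (tuplePt C (strPt (K := K) K) R₂ ≫ symPowProj.mk C hC g) :
          AlgPoints (symPowProj C hC g ⊗ symPowProj C hC g) K) ∈ U ↔
        ell (tupleDiv C R₁ + tupleDiv C R₂ + tupleDiv C A - tupleDiv C Bn) ≤ n := by
  haveI := symPowProj.isProper_hom C hC g
  haveI := symPowProj.surjective_mk_left C hC g
  haveI := symPowProj.isFinite_mk_left C hC g
  haveI : UniversallyClosed (symPowProj.mk C hC g ⊗ₘ symPowProj.mk C hC g).left :=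
    universallyClosed_tensorHom_left _ _
  haveI : Surjective (symPowProj.mk C hC g ⊗ₘ symPowProj.mk C hC g).left := surjective_tensorHom_left _ _
  haveI := geometricallyIntegral_of_isAlgClosed (powC C g).hom
  haveI : IsIntegral (powC C g ⊗ powC C g).left := SchemeOver.isIntegral_left _
  haveI : IsIntegral (C ⊗ (powC C g ⊗ powC C g)).left := SchemeOver.isIntegral_left _
  let D : CartierDivisor (C ⊗ (powC C g ⊗ powC C g)).left :=
    (sumDivisor fun m ↦ (diagonalDivisor C).classPullback
        (C ◁ Fin.append (Fin.append (fun j ↦ fst _ _ ≫ coord C g j) (fun j ↦ snd _ _ ≫ coord C g j))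
          (fun i ↦ const C (powC C g ⊗ powC C g) (A i)) m).left) +
      -(sumDivisor fun m ↦ (diagonalDivisor C).classPullback
        (C ◁ Fin.append (Fin.elim0 : Fin 0 → (powC C g ⊗ powC C g ⟶ C))
          (fun i ↦ const C (powC C g ⊗ powC C g) (Bn i)) m).left)
  obtain ⟨U, hU⟩ := exists_opens_pt_mem_iff_ell_le C hX (symPowProj C hC g ⊗ symPowProj C hC g)
    (powC C g ⊗ powC C g) (symPowProj.mk C hC g ⊗ₘ symPowProj.mk C hC g) D
    (fun w ↦ liftDiv C g hC (w ≫ fst _ _) + liftDiv C g hC (w ≫ snd _ _) + tupleDiv C A - tupleDiv C Bn)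
    (fun β ↦ by
      rw [h0_signedFamily_append_const, Category.assoc, Category.assoc, tensorHom_fst, tensorHom_snd,
        ← Category.assoc, ← Category.assoc, liftDiv_comp_mk, liftDiv_comp_mk]
      simp only [Finset.univ_eq_empty, Finset.sum_empty, zero_add, coordDivisorAt, ptDiv,
        Fin.sum_univ_add, Fin.append_left, Fin.append_right, Category.assoc]) n
  refine ⟨U, fun R₁ R₂ ↦ ?_⟩
  rw [hU, lift_fst, lift_snd, liftDiv_tuplePt_mk, liftDiv_tuplePt_mk]

end Engine

end Literature.AlgebraicGeometry.Motives

end
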